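import Summits.AtomisticToContinuum.Crystallization.Theorems.IsometryAtomsMinimisingLawsHaveAtomsRootEnergyLeOfCopositivityAux
import HarnessLib

/-!
# First variation of Palm copositivity: a.s. the root is bound by at least `2|e*|`
# (stub `stub_rootEnergyLeOfCopositivity` of line `perron_transfer`, crux `IsometryAtoms.MinimisingLawsHaveAtoms`,
# stmt-AtomisticToContinuum-15776)

**Theorem** (`stub_rootEnergyLeOfCopositivity`).  Let `P` be a point-stationary probability law on configurations of
`ℝ³`, almost surely a rooted `δ`-hard-core counting measure, MINIMISING (`E_P[h] ≤ e*`, `h = rootEnergy V_LJ`,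
`e* = ⨅_Q e(Q)`), and suppose PALM COPOSITIVITY: for every measurable weight `w ≤ 1` on configurations,
`E_P[w(μ) Σ_z w(θ_z μ) V⁻(‖z‖)] ≤ E_P[w(μ) Σ_z w(θ_z μ) V⁺(‖z‖)] + 2(-e*) E_P[w²]` (`θ_z μ = μ.map (· - z)`).
Then `h(μ) ≤ e*` for `P`-almost every `μ`.

**Proof** (first variation at `w ≡ 1`).  Let `h'` be the measurable root energy (`EnergyFloor.rootEnergy'`, equal to
`h` on hard-core configurations), `B = {e* < h'}`, `f = 1_B`, and `w_s = 1 - s f` (`0 < s ≤ 1/2`).  All functionals are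
finite on hard-core configurations, so copositivity at `w_s` reads, in real numbers and after expanding,
`0 ≤ (E[u] - 2e*) + s·(first order) + s²·(bounded)`, `u = 2h`.  The Mecke identity symmetrises the first-order term to
`-4 E[f (h' - e*)]`, minimality kills the zeroth-order term, whence `E[f (h' - e*)] ≤ s C / 4` for every small `s > 0`,
i.e. `E[1_B (h' - e*)] ≤ 0`; the integrand is non-negative, so `P(B) = 0`.  All `[folklore]` bookkeeping.
-/

noncomputable section

namespace Summit.AtomisticToContinuum.Crystallization.Theorems.IsometryAtomsMinimisingLawsHaveAtoms

open MeasureTheory ProbabilityTheory Set Filter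
open scoped ENNReal
open Literature.MathematicalPhysics.StatisticalMechanics (lennardJones rootEnergy PeriodicConfiguration)
open Literature.Probability.Process (IsRootedHardCore IsPointStationaryLaw measurable_map_sub_kernel)
open Summit.AtomisticToContinuum.Crystallization.Theorems.ChargedEnergyGapNegative (E3 eStar)
open Summit.AtomisticToContinuum.Crystallization.Theorems.UnimodularEnergy (exists_kernel_eq_self
  measurable_ofReal_lennardJones_norm measurable_ofReal_neg_lennardJones_norm eStar_nonpos)
open Summit.AtomisticToContinuum.Crystallization.Theorems.PalmUnimodularRigidityMinimiserShells.EnergyFloor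
  (rootEnergy' measurable_rootEnergy' rootEnergy'_eq_of_hc rootEnergy'_bounds_of_hc lintegral_pos_le_of_hc
    lintegral_neg_le_of_hc)

/-! ## Assembly -/

section Main

variable {δ : ℝ} {P : Measure (Measure E3)}

/-- **Core of the first variation.** Under the hypotheses of the stub, with `h'` the measurable root energy and
`B = {e* < h'}`: `∫ 1_B (h' - e*) dP ≤ 0`. [folklore] -/
theorem relc_integral_indicator_le (hδ : 0 < δ) [IsProbabilityMeasure P]
    (hcore : ∀ᵐ μ ∂P, IsRootedHardCore δ μ) (hstat : IsPointStationaryLaw P)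
    (hE : (∫ μ, rootEnergy lennardJones μ ∂P) ≤ eStar)
    (hcop : ∀ w : Measure E3 → ℝ≥0∞, Measurable w → (∀ μ, w μ ≤ 1) →
      ∫⁻ μ, w μ * (∫⁻ z, w (Measure.map (fun x => x - z) μ) * ENNReal.ofReal (-lennardJones ‖z‖) ∂μ) ∂P ≤
        ∫⁻ μ, w μ * (∫⁻ z, w (Measure.map (fun x => x - z) μ) * ENNReal.ofReal (lennardJones ‖z‖) ∂μ) ∂P +
          2 * ENNReal.ofReal (-eStar) * ∫⁻ μ, (w μ) ^ 2 ∂P) :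
    ∫ μ, {ν | eStar < rootEnergy' ν}.indicator (fun _ => (1 : ℝ)) μ * (rootEnergy' μ - eStar) ∂P ≤ 0 := by
  obtain ⟨κ, hκs, hκ⟩ := exists_kernel_eq_self hδ
  obtain ⟨p, hp_def⟩ : ∃ p : E3 → ℝ≥0∞, p = fun z => ENNReal.ofReal (lennardJones ‖z‖) := ⟨_, rfl⟩
  obtain ⟨m, hm_def⟩ : ∃ m : E3 → ℝ≥0∞, m = fun z => ENNReal.ofReal (-lennardJones ‖z‖) := ⟨_, rfl⟩
  have hp : Measurable p := hp_def ▸ measurable_ofReal_lennardJones_norm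
  have hm : Measurable m := hm_def ▸ measurable_ofReal_neg_lennardJones_norm
  have hps : ∀ y, p (-y) = p y := fun y => by rw [hp_def]; simp [norm_neg]
  have hms : ∀ y, m (-y) = m y := fun y => by rw [hm_def]; simp [norm_neg]
  -- the bad event and its indicator
  obtain ⟨B, hB_def⟩ : ∃ B : Set (Measure E3), B = {ν | eStar < rootEnergy' ν} := ⟨_, rfl⟩
  have hB : MeasurableSet B := hB_def ▸ measurableSet_lt measurable_const measurable_rootEnergy'
  obtain ⟨f, hf_def⟩ : ∃ f : Measure E3 → ℝ, f = B.indicator (fun _ => (1 : ℝ)) := ⟨_, rfl⟩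
  have hf : Measurable f := hf_def ▸ measurable_const.indicator hB
  have hf01 : ∀ ν, 0 ≤ f ν ∧ f ν ≤ 1 := fun ν => by
    rw [hf_def]
    by_cases h : ν ∈ B
    · simp [Set.indicator_of_mem h]
    · simp [Set.indicator_of_notMem h]
  obtain ⟨F, hF_def⟩ : ∃ F : Measure E3 → ℝ≥0∞, F = fun ν => ENNReal.ofReal (f ν) := ⟨_, rfl⟩
  have hF : Measurable F := hF_def ▸ ENNReal.measurable_ofReal.comp hf
  have hF1 : ∀ ν, F ν ≤ 1 := fun ν => by rw [hF_def]; exact ENNReal.ofReal_le_one.2 (hf01 ν).2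
  have hFf : ∀ ν, (F ν).toReal = f ν := fun ν => by rw [hF_def]; exact ENNReal.toReal_ofReal (hf01 ν).1
  -- the functionals
  obtain ⟨Ap, hAp_def⟩ : ∃ Ap : Measure E3 → ℝ≥0∞, Ap = fun μ => ∫⁻ z, p z ∂(κ μ) := ⟨_, rfl⟩
  obtain ⟨Am, hAm_def⟩ : ∃ Am : Measure E3 → ℝ≥0∞, Am = fun μ => ∫⁻ z, m z ∂(κ μ) := ⟨_, rfl⟩
  obtain ⟨Fp, hFp_def⟩ : ∃ Fp : Measure E3 → ℝ≥0∞,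
      Fp = fun μ => ∫⁻ z, F ((κ μ).map (fun x => x - z)) * p z ∂(κ μ) := ⟨_, rfl⟩
  obtain ⟨Fm, hFm_def⟩ : ∃ Fm : Measure E3 → ℝ≥0∞,
      Fm = fun μ => ∫⁻ z, F ((κ μ).map (fun x => x - z)) * m z ∂(κ μ) := ⟨_, rfl⟩
  have hApm : Measurable Ap := hAp_def ▸ hp.lintegral_kernel
  have hAmm : Measurable Am := hAm_def ▸ hm.lintegral_kernel
  have hFpm : Measurable Fp := hFp_def ▸ relc_measurable_weighted κ hF hp
  have hFmm : Measurable Fm := hFm_def ▸ relc_measurable_weighted κ hF hm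
  set cp : ℝ := 250 / 12 * δ⁻¹ ^ 12 with hcp
  set cm : ℝ := 250 / 6 * δ⁻¹ ^ 6 with hcm
  have hcp0 : 0 ≤ cp := by positivity
  have hcm0 : 0 ≤ cm := by positivity
  have hbAp' : ∀ᵐ μ ∂P, ∫⁻ z, p z ∂(κ μ) ≤ ENNReal.ofReal cp := by
    filter_upwards [hcore] with μ hμ
    rw [hκ μ hμ, hp_def]; exact lintegral_pos_le_of_hc hδ hμ
  have hbAm' : ∀ᵐ μ ∂P, ∫⁻ z, m z ∂(κ μ) ≤ ENNReal.ofReal cm := by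
    filter_upwards [hcore] with μ hμ
    rw [hκ μ hμ, hm_def]; exact lintegral_neg_le_of_hc hδ hμ
  have hbAp : ∀ᵐ μ ∂P, Ap μ ≤ ENNReal.ofReal cp := by rw [hAp_def]; exact hbAp'
  have hbAm : ∀ᵐ μ ∂P, Am μ ≤ ENNReal.ofReal cm := by rw [hAm_def]; exact hbAm'
  have hbFp : ∀ᵐ μ ∂P, Fp μ ≤ ENNReal.ofReal cp := hbAp.mono fun μ h => by
    rw [hFp_def]; rw [hAp_def] at h; exact (relc_weighted_le κ hF1 p μ).trans h
  have hbFm : ∀ᵐ μ ∂P, Fm μ ≤ ENNReal.ofReal cm := hbAm.mono fun μ h => by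
    rw [hFm_def]; rw [hAm_def] at h; exact (relc_weighted_le κ hF1 m μ).trans h
  obtain ⟨hap_i, hap_b, -, -⟩ := relc_pack hApm hcp0 hbAp
  obtain ⟨ham_i, ham_b, -, -⟩ := relc_pack hAmm hcm0 hbAm
  obtain ⟨hfp_i, hfp_b, -, -⟩ := relc_pack hFpm hcp0 hbFp
  obtain ⟨hfm_i, hfm_b, -, -⟩ := relc_pack hFmm hcm0 hbFm
  have hf_bd : ∀ᵐ μ ∂P, ‖f μ‖ ≤ 1 :=
    ae_of_all _ fun μ => by rw [Real.norm_eq_abs, abs_of_nonneg (hf01 μ).1]; exact (hf01 μ).2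
  have hf_i : Integrable f P := Integrable.of_bound hf.aestronglyMeasurable 1 hf_bd
  have hfap_i : Integrable (fun μ => f μ * (Ap μ).toReal) P := hap_i.bdd_mul hf.aestronglyMeasurable hf_bd
  have hfam_i : Integrable (fun μ => f μ * (Am μ).toReal) P := ham_i.bdd_mul hf.aestronglyMeasurable hf_bd
  have hffp_i : Integrable (fun μ => f μ * (Fp μ).toReal) P := hfp_i.bdd_mul hf.aestronglyMeasurable hf_bd
  have hffm_i : Integrable (fun μ => f μ * (Fm μ).toReal) P := hfm_i.bdd_mul hf.aestronglyMeasurable hf_bd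
  have hff_i : Integrable (fun μ => f μ * f μ) P := hf_i.bdd_mul hf.aestronglyMeasurable hf_bd
  -- Mecke
  have hMp : ∫ μ, (Fp μ).toReal ∂P = ∫ μ, f μ * (Ap μ).toReal ∂P := by
    rw [hFp_def, hAp_def]; exact relc_mecke_toReal κ hκ hcore hstat hF hF1 hFf hp hps hcp0 hbAp'
  have hMm : ∫ μ, (Fm μ).toReal ∂P = ∫ μ, f μ * (Am μ).toReal ∂P := by
    rw [hFm_def, hAm_def]; exact relc_mecke_toReal κ hκ hcore hstat hF hF1 hFf hm hms hcm0 hbAm'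
  -- root energy and minimality
  have hroot : ∀ᵐ μ ∂P, rootEnergy lennardJones μ = ((Ap μ).toReal - (Am μ).toReal) / 2 ∧
      rootEnergy' μ = ((Ap μ).toReal - (Am μ).toReal) / 2 := by
    filter_upwards [hcore] with μ hμ
    have h1 : rootEnergy' μ = ((Ap μ).toReal - (Am μ).toReal) / 2 := by
      rw [hAp_def, hAm_def, hp_def, hm_def]; dsimp only; rw [hκ μ hμ]; rfl
    exact ⟨by rw [← h1, rootEnergy'_eq_of_hc hδ hμ]; rfl, h1⟩
  have hmin : ∫ μ, ((Ap μ).toReal - (Am μ).toReal) ∂P ≤ 2 * eStar := by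
    have h1 : ∫ μ, rootEnergy lennardJones μ ∂P = ∫ μ, ((Ap μ).toReal - (Am μ).toReal) / 2 ∂P :=
      integral_congr_ae (hroot.mono fun μ h => h.1)
    have h2 : ∫ μ, ((Ap μ).toReal - (Am μ).toReal) / 2 ∂P = (∫ μ, ((Ap μ).toReal - (Am μ).toReal) ∂P) / 2 :=
      integral_div 2 _
    rw [h1, h2] at hE
    linarith
  -- the second-order bound
  have he0 : 0 ≤ -eStar := neg_nonneg.2 eStar_nonpos
  set C : ℝ := cp + 2 * (-eStar) + 1 with hC_def
  have hC : 0 < C := by positivity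
  have hG2 : ∫ μ, f μ * (Fp μ).toReal ∂P - ∫ μ, f μ * (Fm μ).toReal ∂P -
      2 * eStar * ∫ μ, f μ * f μ ∂P ≤ C := by
    have h1 : ∫ μ, f μ * (Fp μ).toReal ∂P ≤ cp := by
      have : ∫ μ, f μ * (Fp μ).toReal ∂P ≤ ∫ _μ, cp ∂P :=
        integral_mono_ae hffp_i (integrable_const cp) (hfp_b.mono fun μ h => by
          have := hf01 μ; nlinarith [h.1, h.2, this.1, this.2])
      simpa [integral_const, measure_univ] using this
    have h2 : 0 ≤ ∫ μ, f μ * (Fm μ).toReal ∂P :=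
      integral_nonneg_of_ae (hfm_b.mono fun μ h => mul_nonneg (hf01 μ).1 h.1)
    have h3 : ∫ μ, f μ * f μ ∂P ≤ 1 := by
      have : ∫ μ, f μ * f μ ∂P ≤ ∫ _μ, (1 : ℝ) ∂P :=
        integral_mono_ae hff_i (integrable_const 1) (ae_of_all _ fun μ => by
          have := hf01 μ; nlinarith [this.1, this.2])
      simpa [integral_const, measure_univ] using this
    have h4 : 0 ≤ ∫ μ, f μ * f μ ∂P := integral_nonneg fun μ => mul_nonneg (hf01 μ).1 (hf01 μ).1
    nlinarith [h1, h2, h3, h4, he0, hcp0]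
  -- the variation inequality and the first-order condition
  have hvar : ∀ s : ℝ, 0 < s → s ≤ 1 / 2 →
      ∫ μ, (1 - s * f μ) * ((Am μ).toReal - s * (Fm μ).toReal) ∂P ≤
        ∫ μ, (1 - s * f μ) * ((Ap μ).toReal - s * (Fp μ).toReal) ∂P +
          2 * (-eStar) * ∫ μ, (1 - s * f μ) ^ 2 ∂P := fun s hs hs2 =>
    relc_variation hδ κ hκ hcore hcop hf hf01 (fun μ => (Ap μ).toReal) (fun μ => (Am μ).toReal)
      (fun μ => (Fp μ).toReal) (fun μ => (Fm μ).toReal)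
      (fun μ => by rw [hAp_def, hp_def]) (fun μ => by rw [hAm_def, hm_def])
      (fun μ => by rw [hFp_def, hF_def, hp_def]) (fun μ => by rw [hFm_def, hF_def, hm_def]) hs (by linarith)
  have hfo := relc_first_order hf_i hap_i ham_i hfp_i hfm_i hfap_i hfam_i hffp_i hffm_i hff_i hMp hMm hmin
    hG2 hC hvar
  -- back to `1_B (h' - e*)`
  have heq : ∫ μ, {ν | eStar < rootEnergy' ν}.indicator (fun _ => (1 : ℝ)) μ * (rootEnergy' μ - eStar) ∂P =
      ∫ μ, f μ * (((Ap μ).toReal - (Am μ).toReal) / 2 - eStar) ∂P := by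
    refine integral_congr_ae ?_
    filter_upwards [hroot] with μ h
    rw [← h.2, hf_def, hB_def]
  rw [heq]
  exact hfo

/-- **Stub `stub_rootEnergyLeOfCopositivity` (registered, line `perron_transfer`, crux stmt-AtomisticToContinuum-15776):
first variation of Palm copositivity.** For a minimising (`E_P[h] ≤ e*`) point-stationary probability law a.s.
carried by rooted `δ`-hard-core configurations of `ℝ³`, Palm copositivity (for every measurable weight `w ≤ 1`:
`E_P[w Σ_z w(θ_z μ)V⁻] ≤ E_P[w Σ_z w(θ_z μ)V⁺] + 2(-e*)E_P[w²]`) forces `h(μ) ≤ e*` almost surely. [folklore] -/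
theorem stub_rootEnergyLeOfCopositivity :
    ∀ δ : ℝ, 0 < δ → ∀ P : MeasureTheory.Measure (MeasureTheory.Measure (EuclideanSpace ℝ (Fin 3))), MeasureTheory.IsProbabilityMeasure P → (∀ᵐ μ ∂P, Literature.Probability.Process.IsRootedHardCore δ μ) → Literature.Probability.Process.IsPointStationaryLaw P → (∫ μ, Literature.MathematicalPhysics.StatisticalMechanics.rootEnergy Literature.MathematicalPhysics.StatisticalMechanics.lennardJones μ ∂P) ≤ (⨅ Q : Literature.MathematicalPhysics.StatisticalMechanics.PeriodicConfiguration 3, Q.energyPerParticle Literature.MathematicalPhysics.StatisticalMechanics.lennardJones) → (∀ w : MeasureTheory.Measure (EuclideanSpace ℝ (Fin 3)) → ENNReal, Measurable w → (∀ μ, w μ ≤ 1) → ∫⁻ μ, w μ * (∫⁻ z, w (MeasureTheory.Measure.map (fun x => x - z) μ) * ENNReal.ofReal (-Literature.MathematicalPhysics.StatisticalMechanics.lennardJones ‖z‖) ∂μ) ∂P ≤ ∫⁻ μ, w μ * (∫⁻ z, w (MeasureTheory.Measure.map (fun x => x - z) μ) * ENNReal.ofReal (Literature.MathematicalPhysics.StatisticalMechanics.lennardJones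 ‖z‖) ∂μ) ∂P + 2 * ENNReal.ofReal (-(⨅ Q : Literature.MathematicalPhysics.StatisticalMechanics.PeriodicConfiguration 3, Q.energyPerParticle Literature.MathematicalPhysics.StatisticalMechanics.lennardJones)) * ∫⁻ μ, (w μ) ^ 2 ∂P) → ∀ᵐ μ ∂P, Literature.MathematicalPhysics.StatisticalMechanics.rootEnergy Literature.MathematicalPhysics.StatisticalMechanics.lennardJones μ ≤ (⨅ Q : Literature.MathematicalPhysics.StatisticalMechanics.PeriodicConfiguration 3, Q.energyPerParticle Literature.MathematicalPhysics.StatisticalMechanics.lennardJones) := by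
  intro δ hδ P hP hcore hstat hE hcop
  have hle : ∫ μ, {ν | eStar < rootEnergy' ν}.indicator (fun _ => (1 : ℝ)) μ * (rootEnergy' μ - eStar) ∂P ≤ 0 :=
    relc_integral_indicator_le hδ hcore hstat hE hcop
  obtain ⟨B, hB_def⟩ : ∃ B : Set (Measure E3), B = {ν | eStar < rootEnergy' ν} := ⟨_, rfl⟩
  have hB : MeasurableSet B := hB_def ▸ measurableSet_lt measurable_const measurable_rootEnergy'
  obtain ⟨g, hg_def⟩ : ∃ g : Measure E3 → ℝ,
      g = fun μ => B.indicator (fun _ => (1 : ℝ)) μ * (rootEnergy' μ - eStar) := ⟨_, rfl⟩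
  rw [← hB_def] at hle
  have hle' : ∫ μ, g μ ∂P ≤ 0 := by rw [hg_def]; exact hle
  have hg0 : ∀ μ, 0 ≤ g μ := fun μ => by
    rw [hg_def]
    by_cases h : μ ∈ B
    · have h' : eStar < rootEnergy' μ := by rw [hB_def] at h; exact h
      simp only [Set.indicator_of_mem h, one_mul, sub_nonneg]; exact h'.le
    · simp only [Set.indicator_of_notMem h, zero_mul]; exact le_rfl
  have hgm : Measurable g :=
    hg_def ▸ (measurable_const.indicator hB).mul (measurable_rootEnergy'.sub measurable_const)
  have hgb : ∀ᵐ μ ∂P, ‖g μ‖ ≤ 250 / 24 * δ⁻¹ ^ 12 + |eStar| := by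
    filter_upwards [hcore] with μ hμ
    have hb := rootEnergy'_bounds_of_hc hδ hμ
    rw [Real.norm_eq_abs, abs_of_nonneg (hg0 μ), hg_def]
    by_cases h : μ ∈ B
    · simp only [Set.indicator_of_mem h, one_mul]
      linarith [hb.2, neg_abs_le eStar]
    · simp only [Set.indicator_of_notMem h, zero_mul]; positivity
  have hgi : Integrable g P := Integrable.of_bound hgm.aestronglyMeasurable _ hgb
  have hzero : ∫ μ, g μ ∂P = 0 := le_antisymm hle' (integral_nonneg hg0)
  have hae : g =ᵐ[P] 0 := (integral_eq_zero_iff_of_nonneg_ae (ae_of_all _ hg0) hgi).1 hzero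
  filter_upwards [hae, hcore] with μ hμ hμc
  have hnot : μ ∉ B := fun h => by
    have h' : eStar < rootEnergy' μ := by rw [hB_def] at h; exact h
    have : g μ = rootEnergy' μ - eStar := by rw [hg_def]; simp only [Set.indicator_of_mem h, one_mul]
    rw [hμ, Pi.zero_apply] at this
    linarith
  have h1 : rootEnergy' μ ≤ eStar := by
    by_contra hlt
    exact hnot (by rw [hB_def]; exact not_le.1 hlt)
  have h2 : rootEnergy' μ = rootEnergy lennardJones μ := by
    rw [rootEnergy'_eq_of_hc hδ hμc]; rfl
  rw [← h2]
  exact h1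

end Main

end Summit.AtomisticToContinuum.Crystallization.Theorems.IsometryAtomsMinimisingLawsHaveAtoms

end
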